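import Literature.NumberTheory.Automorphic.PairLFunctionPolesEqConjFirstMoment
import Literature.NumberTheory.Automorphic.ThinTestFunction
import HarnessLib

/-!
# Arthur–Clozel (2.3) from the first moment of a THIN datum at `s = 1`

Topic `NumberTheory/Automorphic`; namespace `Literature.NumberTheory.Automorphic`. Proof file (theorems
only) under the named fact `JacquetShalika1981_partialPairL_pole_of_eq_conj` (`PairLFunctionPoles`;
Arthur–Clozel (1989), Ch. 3 §2 (2.3): for unitary cuspidal `π ≅ σ̃`, "the limit
`lim_{s → 1, Re s > 1} (s - 1) L^S(s, π ⊗ σ)` exists and is finite and non-zero"; Jacquet–Shalika II,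
Prop. 3.6).

`JacquetShalika1981_partialPairL_pole_of_eq_conj_of_firstMoment` (`PairLFunctionPolesEqConjFirstMoment`)
reduces the named fact, in every rank, to the finiteness AT `s = 1` of the `S'`-part of the unfolded
Rankin–Selberg integral of a datum `(W_{S_η f}, Φ)` with the STANDARD test function `Φ = Φ_∞ ⊗ 𝟙_{𝒪̂ⁿ}`
and for ALL finite `S'`. At a ramified finite place `v` that hypothesis involves the Whittaker
functions of all the `GL_n(𝒪_v)`-translates of the vector, i.e. the full local theory of
Jacquet–Shalika I, §1. The printed proof instead chooses the test function freely at the bad places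
(Jacquet–Shalika (1981), §4 and (5.1); Jacquet–Piatetski-Shapiro–Shalika (1983), (2.7)). This file
re-runs the reduction for the **thin** test function `thinTestFun n K Φ_∞^{Gauss} T m`
(`ThinTestFunction`: `Φ_v = 𝟙_{e_n + 𝔭_v^m 𝒪_vⁿ}` at `v ∈ T`, `𝟙_{𝒪_vⁿ}` elsewhere) and for ONE finite
set `S' = T` attached to the datum:

* `setLIntegral_torusIntegrand_unitBox_ne_zero_of_continuous` — positivity of the unit-box integral
  for a continuous test function positive at the base point (the variant of
  `setLIntegral_torusIntegrand_unitBox_ne_zero` of `RankinSelbergTorusPositivity`);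
* `rankinSelbergTorusIntegralC_whittakerCoeff_thin_eq_partialPairL_mul` —
  `Ψ(s; W_φ, W̄_φ, Φ) = L^{S'}(s, α ⊗ ᾱ) · Ψ_{S'}(s)` on `Re s > 1` for the thin test function, `T ⊆ S'`
  (the proof of `rankinSelbergTorusIntegralC_whittakerCoeff_eq_partialPairL_mul` verbatim, the test
  function being spherical off `T`);
* `JacquetShalika1981_partialPairL_pole_of_eq_conj_of_thinFirstMoment` (**main**) — the named fact
  in rank `n` over `K` follows from: for every cuspidal `Π` and every finite set `T₀` of finite places
  there are a finite `T ⊇ T₀`, a depth `m`, a level `𝔫 ≠ 0` supported in `T`, `f ∈ Π` and a test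
  function `η`, left `K(𝔫)`-invariant, with `W_{S_η f}(1) ≠ 0`, such that for all Haar measures the
  `T`-part of the unfolded integral of `(W_{S_η f}, thinTestFun Φ_∞^{Gauss} T m)` is finite at the
  real point `s = 1`.

The global inputs are those of `…_of_firstMoment`: residue (`exists_residue_datum`, here with
`∫ Φ ≠ 0` from `integral_ofReal_thinTestFun_gauss_ne_zero`), unfolding on `1 < Re s < 2`
(`exists_rankinSelbergIntegral_eq_mul_rankinSelbergTorusIntegralC`, any Schwartz–Bruhat `Φ ≥ 0`), the
Euler factorisation above, the global finiteness of the second moment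
(`rankinSelbergTorusIntegral_whittakerCoeff_ne_top_of_mem_piSchwartzBruhat`), the moment lemma
`exists_ne_zero_tendsto_sub_one_mul_of_integral_mul_cpow` and the change of `S`
(`JacquetShalika1981_partialPairL_pole_of_eq_conj_of_one_family'`).

## References

* J. Arthur, L. Clozel, *Simple algebras, base change, and the advanced theory of the trace formula*,
  Ann. of Math. Stud. 120 (1989), Ch. 3 §2, (2.3), p. 171 [ArthurClozelAMS120].
* H. Jacquet, J. A. Shalika, *On Euler products and the classification of automorphic representations
  I*, Amer. J. Math. 103 (1981), §4, (5.1) [JacquetShalikaAJM1981]; *II*, ibid. 777–815, Prop. 3.6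
  [JacquetShalikaAJM1981II].
* H. Jacquet, I. I. Piatetski-Shapiro, J. A. Shalika, *Rankin–Selberg convolutions*, Amer. J. Math.
  105 (1983), §2, (2.7) [JacquetPiatetskiShapiroShalika1983].
* J. W. Cogdell, *Analytic theory of L-functions for GL_n*, in *An Introduction to the Langlands Program*
  (2004), §2.3, Thm. 2.2, §4.2 [CogdellAnalyticTheory2004].
-/

noncomputable section

open MeasureTheory Measure NumberField IsDedekindDomain Matrix Set Filter Finset Topology
open scoped MatrixGroups ENNReal NNReal Pointwise ValuativeRel ComplexConjugate
open Literature.RingTheory.SymmetricFunctions.SymmPoly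
open Literature.NumberTheory.GaloisRepresentations (ideleGroup unitIdeles isOpen_unitIdeles
  mem_unitIdeles_iff)

namespace Literature.NumberTheory.Automorphic

-- the automorphic quotient carries the tree's Borel σ-algebra, not Mathlib's quotient σ-algebra
attribute [-instance] Quotient.instMeasurableSpace QuotientGroup.measurableSpace

/-! ### Positivity of the unit-box integral for a continuous test function -/

section Positivity

variable {n : ℕ} {K : Type} [Field K] [NumberField K]

attribute [local instance] adelicBorel borelSpace_adelic locallyCompactSpace_adelic
  secondCountableTopology_gl_adelic

/-- **Positivity of the unit-box Rankin–Selberg integral for a continuous test function.** Let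
`W : GL_n(𝔸_K) → ℂ` and `Φ : 𝔸_Kⁿ → ℝ` be continuous, `W(diag(a₀) k₀) ≠ 0` and `Φ(e_n diag(a₀) k₀) > 0`
at a torus point with `a₀ ∈ unitBox Good`, and let `νA`, `νK` be s-finite measures positive on
non-empty open sets. Then the integral of `|W(diag(a) k)|² Φ(e_n diag(a) k) |det a|^σ δ_B(a)⁻¹` over
`unitBox Good × K` is non-zero. [folklore] -/
theorem setLIntegral_torusIntegrand_unitBox_ne_zero_of_continuous
    [MeasurableSpace (ideleGroup K)] [BorelSpace (ideleGroup K)]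
    {W : GL (Fin n) (AdeleRing (𝓞 K) K) → ℂ} (hW : Continuous W)
    {Φ : (Fin n → AdeleRing (𝓞 K) K) → ℝ} (hΦc : Continuous Φ)
    {a₀ : Fin n → ideleGroup K} {k₀ : ↥(maximalCompactAdelic n K)}
    (hW0 : W (torusPoint n K (a₀, k₀)) ≠ 0) (hΦ0 : 0 < Φ (lastRow n K (torusPoint n K (a₀, k₀))))
    {Good : Set (HeightOneSpectrum (𝓞 K))} (ha₀ : a₀ ∈ unitBox Good)
    (σ : ℝ) (νA : Measure (Fin n → ideleGroup K)) [SFinite νA] [νA.IsOpenPosMeasure]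
    (νK : Measure ↥(maximalCompactAdelic n K)) [SFinite νK] [νK.IsOpenPosMeasure] :
    ∫⁻ p in unitBox Good ×ˢ Set.univ, torusIntegrand n K W Φ σ p ∂(νA.prod νK) ≠ 0 := by
  classical
  set G : (Fin n → ideleGroup K) × ↥(maximalCompactAdelic n K) → ℝ := fun p =>
    ‖W (torusPoint n K p)‖ ^ 2 * Φ (lastRow n K (torusPoint n K p)) * torusWeight n K σ p.1 with hG
  have hGc : Continuous G := by
    refine ((continuous_norm.comp (hW.comp continuous_torusPoint)).pow 2).mul ?_ |>.mul
      ((continuous_torusWeight σ).comp continuous_fst)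
    exact hΦc.comp (continuous_lastRow.comp continuous_torusPoint)
  have hG0 : 0 < G (a₀, k₀) :=
    mul_pos (mul_pos (pow_pos (norm_pos_iff.2 hW0) 2) hΦ0) (torusWeight_pos σ a₀)
  -- the open box of unit multiples of `a₀`
  set B : Set (Fin n → ideleGroup K) := {a | ∀ i, (a₀ i)⁻¹ * a i ∈ unitIdeles K} with hB
  have hBo : IsOpen B := by
    have hB' : B = (fun a : Fin n → ideleGroup K => a₀⁻¹ * a) ⁻¹'
        Set.pi Set.univ (fun _ => (unitIdeles K : Set (ideleGroup K))) := by
      ext a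
      simp only [hB, Set.mem_setOf_eq, Set.mem_preimage, Set.mem_univ_pi, Pi.mul_apply,
        Pi.inv_apply]
      rfl
    rw [hB']
    exact (isOpen_set_pi Set.finite_univ fun _ _ => isOpen_unitIdeles K).preimage
      (continuous_const.mul continuous_id)
  have ha₀B : a₀ ∈ B := fun i => by
    rw [inv_mul_cancel]
    exact (unitIdeles K).one_mem
  have hBunit : ∀ a ∈ B, a ∈ unitBox Good := by
    intro a ha w hw i
    have he : a i = a₀ i * ((a₀ i)⁻¹ * a i) := by rw [mul_inv_cancel_left]
    rw [he, ideleGroup_snd_mul_apply, map_mul, ha₀ w hw i, mem_unitIdeles_iff.1 (ha i) w, one_mul]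
  have hBeq : ∀ p : (Fin n → ideleGroup K) × ↥(maximalCompactAdelic n K),
      torusIntegrand n K W Φ σ p = ENNReal.ofReal (G p) := fun p => rfl
  -- the open set where `G > G₀ / 2`, and an open measurable box inside it
  set O : Set ((Fin n → ideleGroup K) × ↥(maximalCompactAdelic n K)) :=
    {p | G (a₀, k₀) / 2 < G p} ∩ B ×ˢ Set.univ with hO
  have hOo : IsOpen O := (isOpen_lt continuous_const hGc).inter (hBo.prod isOpen_univ)
  have hO0 : (a₀, k₀) ∈ O := ⟨by simp only [Set.mem_setOf_eq]; linarith, ha₀B, Set.mem_univ _⟩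
  obtain ⟨O₁, O₂, hO₁o, hO₂o, ha₀O₁, hk₀O₂, hsub⟩ := isOpen_prod_iff.1 hOo a₀ k₀ hO0
  obtain ⟨I, u, hu, hIsub⟩ := isOpen_pi_iff.1 hO₁o a₀ ha₀O₁
  set T : Set ((Fin n → ideleGroup K) × ↥(maximalCompactAdelic n K)) :=
    (↑I : Set (Fin n)).pi u ×ˢ O₂ with hT
  have hTm : MeasurableSet T :=
    (MeasurableSet.pi I.countable_toSet fun i hi => (hu i hi).1.measurableSet).prod hO₂o.measurableSet
  have hTO : T ⊆ O := fun p hp => hsub ⟨hIsub hp.1, hp.2⟩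
  have hTsub : T ⊆ unitBox Good ×ˢ Set.univ := fun p hp =>
    ⟨hBunit p.1 (hTO hp).2.1, Set.mem_univ _⟩
  have hTpos : 0 < (νA.prod νK) T := by
    rw [hT, Measure.prod_prod]
    refine ENNReal.mul_pos ?_ ?_
    · exact ((isOpen_set_pi I.finite_toSet fun i hi => (hu i hi).1).measure_pos νA
        ⟨a₀, fun i hi => (hu i hi).2⟩).ne'
    · exact (hO₂o.measure_pos νK ⟨k₀, hk₀O₂⟩).ne'
  have hlow : ∀ p ∈ T, ENNReal.ofReal (G (a₀, k₀) / 2) ≤ torusIntegrand n K W Φ σ p := by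
    intro p hp
    have hpO : p ∈ O := hTO hp
    rw [hBeq p]
    exact ENNReal.ofReal_le_ofReal (le_of_lt hpO.1)
  intro h0
  have hle : ENNReal.ofReal (G (a₀, k₀) / 2) * (νA.prod νK) T ≤ 0 :=
    calc ENNReal.ofReal (G (a₀, k₀) / 2) * (νA.prod νK) T
        = ∫⁻ _ in T, ENNReal.ofReal (G (a₀, k₀) / 2) ∂(νA.prod νK) := (setLIntegral_const _ _).symm
      _ ≤ ∫⁻ p in T, torusIntegrand n K W Φ σ p ∂(νA.prod νK) := setLIntegral_mono' hTm hlow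
      _ ≤ ∫⁻ p in unitBox Good ×ˢ Set.univ, torusIntegrand n K W Φ σ p ∂(νA.prod νK) :=
          lintegral_mono_set hTsub
      _ = 0 := h0
  have hpos : 0 < ENNReal.ofReal (G (a₀, k₀) / 2) * (νA.prod νK) T :=
    ENNReal.mul_pos (ENNReal.ofReal_pos.2 (half_pos hG0)).ne' hTpos.ne'
  exact hpos.ne' (nonpos_iff_eq_zero.1 hle)

end Positivity

/-! ### The Euler factorisation for the thin test function -/

section Cuspidal

open ValuativeRel

variable {n : ℕ} {K : Type} [Field K] [NumberField K]
  {μ : Measure (AdelicGroupData.gl n K).automorphicQuotient} [(AdelicGroupData.gl n K).IsAutomorphicMeasure μ]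
variable [MeasurableSpace ↥(adelicUnipotent n K)] [BorelSpace ↥(adelicUnipotent n K)]
  [MeasurableConstSMul ↥(rationalUnipotent n K) ↥(adelicUnipotent n K)]
  {ν : Measure ↥(adelicUnipotent n K)} [IsFiniteMeasureOnCompacts ν]
  [SMulInvariantMeasure ↥(rationalUnipotent n K) ↥(adelicUnipotent n K) ν] [ν.IsMulRightInvariant]
  {𝓕 : Set ↥(adelicUnipotent n K)} {ψ : AddChar (AdeleRing (𝓞 K) K) Circle}
variable [MeasurableSpace (ideleGroup K)] [BorelSpace (ideleGroup K)]

attribute [local instance] adelicBorel borelSpace_adelic locallyCompactSpace_adelic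
  secondCountableTopology_gl_adelic secondCountableTopology_ideleGroup glAdeleBorel borelSpace_glAdele

/-- **`Ψ(s; W_φ, W̄_φ, Φ) = L^{S'}(s, α ⊗ ᾱ) · Ψ_{S'}(s)` on `re s > 1` for the thin test function.**
Let `π` be a cuspidal automorphic representation of `GL_n(𝔸_K)` (`0 < n`) with Satake family `α` off `S`,
`f ∈ π`, `η` a continuous compactly supported left `K(𝔫₀)`-invariant weight, `φ = invQuot (S_η f)`,
`W = W_φ` its global Whittaker coefficient, `Φ = thinTestFun n K Φ_∞ T m` (`Φ_∞ ≥ 0`, `g ↦ Φ(e_n g)`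
measurable) and `S' ⊇ S ∪ T` a set of finite places off which `v ∤ 𝔫₀` and `ψ_v` has conductor `𝒪_v`.
For `re s > 1`, if `Ψ(re s)` is finite and the unit-box integral over `B({v ∉ S'}) × K` is positive,
then `Ψ(s; W, W̄, Φ) = partialPairL S' α ᾱ s · ∫_{B({v ∉ S'}) × K} |W|² Φ |det a|^s δ_B⁻¹` — the proof of
`rankinSelbergTorusIntegralC_whittakerCoeff_eq_partialPairL_mul` verbatim (the thin test function is
spherical at the places off `T`, `isLastRowSphericalAt_thinTestFun`).
[cite: JacquetShalikaAJM1981, §2 Prop. (2.3), §4] [cite: CogdellAnalyticTheory2004, Thm. 2.2, Thm. 3.3] -/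
theorem rankinSelbergTorusIntegralC_whittakerCoeff_thin_eq_partialPairL_mul (hn : 0 < n)
    (P : CuspidalAutomorphicRepGL n K μ) {S : Set (HeightOneSpectrum (𝓞 K))} {α : SatakeFamily K}
    (hα : IsSatakeFamilyOf P S α) {𝔫₀ : Ideal (𝓞 K)} (h𝔫₀ : 𝔫₀ ≠ 0)
    {η : (AdelicGroupData.gl n K).Adelic → ℝ} (hη : Continuous η) (hηs : HasCompactSupport η)
    (hηK : ∀ k : (AdelicGroupData.gl n K).Adelic, k ∈ principalCongruenceLevel n K 𝔫₀ →
      ∀ g : (AdelicGroupData.gl n K).Adelic, η (k * g) = η g)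
    (f : P.1.toSubmodule) (h𝓕 : IsFundamentalDomain ↥(rationalUnipotent n K) 𝓕 ν) (h𝓕m : MeasurableSet 𝓕)
    (h𝓕c : IsCompact (closure 𝓕)) (hψ : IsGlobalAddChar K ψ)
    {T : Finset (HeightOneSpectrum (𝓞 K))} (m : ℕ)
    {S' : Set (HeightOneSpectrum (𝓞 K))} (hSS' : S ⊆ S') (hTS' : (↑T : Set (HeightOneSpectrum (𝓞 K))) ⊆ S')
    (hGood : ∀ v ∉ S', ¬ v.asIdeal ∣ 𝔫₀ ∧ (∀ c ∈ 𝒪[v.adicCompletion K], ψ.adicComponent v c = 1) ∧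
      ∀ ϖ : v.adicCompletion K, Valued.v ϖ = WithZero.exp (-1 : ℤ) →
        ∃ c ∈ 𝒪[v.adicCompletion K], ψ.adicComponent v (ϖ⁻¹ * c) ≠ 1)
    {x : HeightOneSpectrum (𝓞 K) → Fin n → ℂ}
    (hx : ∀ v ∉ S', (Finset.univ : Finset (Fin n)).val.map (x v) = α v)
    {Φinf : (Fin n → InfiniteAdeleRing K) → ℝ} (hΦinf : ∀ z, 0 ≤ Φinf z)
    (hΦm : Measurable fun g : GL (Fin n) (AdeleRing (𝓞 K) K) => thinTestFun n K Φinf T m (lastRow n K g))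
    (νA : Measure (Fin n → ideleGroup K)) [νA.IsMulLeftInvariant] [SFinite νA]
    (νK : Measure ↥(maximalCompactAdelic n K)) [SFinite νK] {s : ℂ} (hs : 1 < s.re)
    (hfin : rankinSelbergTorusIntegral n K νA νK
      (whittakerCoeff ν 𝓕 ψ
        (invQuot (AdelicGroupData.gl n K) (smoothedForm η (f : (AdelicGroupData.gl n K).L2 μ))))
      (thinTestFun n K Φinf T m) s.re ≠ ⊤)
    (hpos : ∫⁻ p in unitBox {v | v ∉ S'} ×ˢ Set.univ, torusIntegrand n K
      (whittakerCoeff ν 𝓕 ψ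
        (invQuot (AdelicGroupData.gl n K) (smoothedForm η (f : (AdelicGroupData.gl n K).L2 μ))))
      (thinTestFun n K Φinf T m) s.re p ∂(νA.prod νK) ≠ 0) :
    rankinSelbergTorusIntegralC n K νA νK
        (whittakerCoeff ν 𝓕 ψ
          (invQuot (AdelicGroupData.gl n K) (smoothedForm η (f : (AdelicGroupData.gl n K).L2 μ))))
        (thinTestFun n K Φinf T m) s =
      partialPairL S' α (fun v => (α v).map conj) s *
        ∫ p in unitBox {v | v ∉ S'} ×ˢ Set.univ, torusIntegrandC n K
          (whittakerCoeff ν 𝓕 ψ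
            (invQuot (AdelicGroupData.gl n K) (smoothedForm η (f : (AdelicGroupData.gl n K).L2 μ))))
          (thinTestFun n K Φinf T m) s p ∂(νA.prod νK) := by
  classical
  set φ : GL (Fin n) (AdeleRing (𝓞 K) K) → ℂ :=
    invQuot (AdelicGroupData.gl n K) (smoothedForm η (f : (AdelicGroupData.gl n K).L2 μ)) with hφ
  set W : GL (Fin n) (AdeleRing (𝓞 K) K) → ℂ := whittakerCoeff ν 𝓕 ψ φ with hWdef
  set Φ : (Fin n → AdeleRing (𝓞 K) K) → ℝ := thinTestFun n K Φinf T m with hΦdef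
  have hGood' : ∀ v ∈ {v : HeightOneSpectrum (𝓞 K) | v ∉ S'}, v ∉ S ∧ ¬ v.asIdeal ∣ 𝔫₀ ∧
      (∀ c ∈ 𝒪[v.adicCompletion K], ψ.adicComponent v c = 1) ∧
      ∀ ϖ : v.adicCompletion K, Valued.v ϖ = WithZero.exp (-1 : ℤ) →
        ∃ c ∈ 𝒪[v.adicCompletion K], ψ.adicComponent v (ϖ⁻¹ * c) ≠ 1 :=
    fun v hv => ⟨fun h => hv (hSS' h), hGood v hv⟩
  have hT' : ∀ v ∉ S', v ∉ T := fun v hv h => hv (hTS' h)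
  -- the uniformizers of the Satake data at the good places
  have hex : ∀ v ∉ S', ∃ ϖ : (v.adicCompletion K)ˣ, IsTorusUnramifiedAt n K W v ϖ (x v) := fun v hv =>
    exists_isTorusUnramifiedAt_whittakerCoeff_smoothedForm P hα h𝔫₀ (hGood' v hv).1 (hGood v hv).1
      hη hηs hηK f (hx v hv) h𝓕 h𝓕c hψ (hGood v hv).2.1 (hGood v hv).2.2
  let ϖ : ∀ v : HeightOneSpectrum (𝓞 K), (v.adicCompletion K)ˣ := fun v =>
    if hv : v ∉ S' then Classical.choose (hex v hv) else 1
  have hW : ∀ v ∉ S', IsTorusUnramifiedAt n K W v (ϖ v) (x v) := fun v hv => by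
    simp only [ϖ, dif_pos hv]
    exact Classical.choose_spec (hex v hv)
  -- central invariance of `‖W‖`
  obtain ⟨ω, hu, -, -, -, -, hcl⟩ := P.exists_centralCharacter_smoothedForm
  have hWZ : ∀ (z : ideleGroup K) (g : GL (Fin n) (AdeleRing (𝓞 K) K)),
      ‖W (Matrix.GeneralLinearGroup.scalar (Fin n) z * g)‖ = ‖W g‖ := fun z g => by
    rw [hWdef, whittakerCoeff_scalar_mul (fun g' => hcl η f z g') g, norm_mul, hu z, one_mul]
  -- the test function
  have hΦ0 : ∀ y, 0 ≤ Φ y := thinTestFun_nonneg hΦinf T m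
  have hΦv : ∀ v ∉ S', ∀ y : Fin n → AdeleRing (𝓞 K) K, Φ y ≠ 0 → ∀ j, Valued.v ((y j).2 v) ≤ 1 :=
    fun v _ y hy j => thinTestFun_ne_zero_valued_le_one hy j v
  -- integrability of the complex integrand
  have hWc : Continuous W := continuous_whittakerCoeff h𝓕m h𝓕c hψ.continuous
    (continuous_invQuot_smoothedForm hη hηs _)
  have hint : Integrable (torusIntegrandC n K W Φ s) (νA.prod νK) :=
    (integrable_torusIntegrandC_iff νA νK hΦ0 (measurable_torusIntegrandC_of_continuous hWc hΦm s).aestronglyMeasurable).2 hfin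
  -- finiteness of the real torus sums at `re s`
  obtain ⟨C, hC, hle⟩ := exists_prod_schurSelfSum_le_of_rankinSelbergTorusIntegral_ne_top
    (Good := {v : HeightOneSpectrum (𝓞 K) | v ∉ S'}) νA νK hW
    (fun v hv => isLastRowSphericalAt_thinTestFun Φinf m (hT' v hv)) hfin hpos
  have hT : ∀ v ∉ S', schurSelfSum (x v) ((v.residueCard : ℝ) ^ (-s.re)) ≠ ⊤ := fun v hv => by
    have h := hle {v} (by simpa using hv)
    rw [Finset.prod_singleton] at h
    exact ne_top_of_le_ne_top hC h
  -- the Euler product of the local factors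
  have hL := hasProd_partialPairL JacquetShalika1981_multipliable_partialPairL_holds P P.conj (hα.mono hSS')
    (hα.mono hSS').conj hs
  exact rankinSelbergTorusIntegralC_eq_mul_setIntegral_of_hasProd νA νK hn hW hWZ
    (fun v hv => isLastRowSphericalAt_thinTestFun Φinf m (hT' v hv)) hΦv hΦ0 hint hT hx hL

end Cuspidal

/-! ### (2.3) from the first moment of a thin datum -/

section FirstMoment

variable {n : ℕ} {K : Type} [Field K] [NumberField K]
variable {μ' : Measure (AdelicGroupData.gl n K).automorphicQuotient}
  [(AdelicGroupData.gl n K).IsAutomorphicMeasure μ']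

attribute [local instance] adelicBorel borelSpace_adelic locallyCompactSpace_adelic secondCountableTopology_gl_adelic
  glAdeleBorel borelSpace_glAdele

/-- **Arthur–Clozel (2.3) from the first moment of a thin datum at `s = 1`.** Suppose that for every
cuspidal automorphic representation `Π` of `GL_n(𝔸_K)` and every finite set `T₀` of finite places there
are a finite set `T ⊇ T₀`, a depth `m`, a non-zero level `𝔫` all of whose prime factors lie in `T`,
`f ∈ Π` and a test function `η`, left `K(𝔫)`-invariant, such that the global Whittaker coefficient of
`S_η f` does not vanish at `1` and, for all Haar measures, the `T`-part of the unfolded Rankin–Selberg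
integral of the datum `(W_{S_η f}, thinTestFun Φ_∞^{Gauss} T m)` is finite AT the real point `s = 1`:
`∫⁻_{B({v ∉ T}) × K} |W(diag(a) k)|² Φ(e_n diag(a) k) |det a| δ_B(a)⁻¹ d(νA × νK) < ∞`.
Then the named fact `JacquetShalika1981_partialPairL_pole_of_eq_conj` holds in rank `n` over `K`.
(With the thin test function the local integrals at the places of `T` are integrals over
`P_n(K_v) · K_v(𝔭^m)` only, as in the printed proofs: Jacquet–Shalika (1981), §4, (5.1);
Jacquet–Piatetski-Shapiro–Shalika (1983), (2.7).) Proof: as for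
`JacquetShalika1981_partialPairL_pole_of_eq_conj_of_firstMoment`, with `S' = T` for
`T₀ = S₁ ∪ S_ψ` (`S₁` the exceptional set of a Satake family of `Π`, `S_ψ` the ramification of Tate's
character) and the base torus point `(1, 1)`.
[cite: ArthurClozelAMS120, Ch. 3 §2 (2.3)] [cite: JacquetShalikaAJM1981, §4, (5.1); II Prop. 3.6]
[cite: CogdellAnalyticTheory2004, §4.2] -/
theorem JacquetShalika1981_partialPairL_pole_of_eq_conj_of_thinFirstMoment
    (hfin : ∀ [MeasurableSpace (AdeleRing (𝓞 K) K)] [BorelSpace (AdeleRing (𝓞 K) K)]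
      (P : CuspidalAutomorphicRepGL n K μ') (T₀ : Finset (HeightOneSpectrum (𝓞 K))),
      ∃ (T : Finset (HeightOneSpectrum (𝓞 K))) (_ : T₀ ⊆ T) (m : ℕ) (𝔫 : Ideal (𝓞 K)) (_ : 𝔫 ≠ 0)
        (_ : ∀ v : HeightOneSpectrum (𝓞 K), v.asIdeal ∣ 𝔫 → v ∈ T)
        (f : P.1.toSubmodule) (η : (AdelicGroupData.gl n K).Adelic → ℝ), IsTestFunctionGL n K η ∧
        (∀ k : (AdelicGroupData.gl n K).Adelic, k ∈ principalCongruenceLevel n K 𝔫 →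
          ∀ g : (AdelicGroupData.gl n K).Adelic, η (k * g) = η g) ∧
        (∀ (ν₀ : Measure ↥(adelicUnipotent n K)) (_ : IsHaarMeasure ν₀),
          whittakerCoeff ν₀ (unipotentTateDomain n K) (adeleAddChar K)
            (invQuot (AdelicGroupData.gl n K) (smoothedForm η (f : (AdelicGroupData.gl n K).L2 μ'))) 1 ≠ 0) ∧
        ∀ (νA : Measure (Fin n → ideleGroup K)) (_ : IsHaarMeasure νA)
          (νK : Measure ↥(maximalCompactAdelic n K)) (_ : IsHaarMeasure νK)
          (ν₀ : Measure ↥(adelicUnipotent n K)) (_ : IsHaarMeasure ν₀),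
          ∫⁻ p in unitBox {v | v ∉ (↑T : Set (HeightOneSpectrum (𝓞 K)))} ×ˢ Set.univ, torusIntegrand n K
              (whittakerCoeff ν₀ (unipotentTateDomain n K) (adeleAddChar K)
                (invQuot (AdelicGroupData.gl n K) (smoothedForm η (f : (AdelicGroupData.gl n K).L2 μ'))))
              (thinTestFun n K (gaussArchTestFun n K) T m) 1 p ∂(νA.prod νK) ≠ ⊤) :
    JacquetShalika1981_partialPairL_pole_of_eq_conj (n := n) (K := K) (μ := μ') := by
  refine JacquetShalika1981_partialPairL_pole_of_eq_conj_of_one_family'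
    JacquetShalika1981_multipliable_partialPairL_holds
    (fun P _ _ hα _ hv _ ha => norm_satakeParameter_lt_sqrt_of_isGeneric
      exists_hasLocalComponentAt_holds Flath1979_isSatakeParameter_of_hasLocalComponentAt_holds
      Shalika1974_isGeneric_of_hasLocalComponentAt_holds
      (fun _ _ _ _ _ => JacquetShalika1981_norm_lt_sqrt_of_isGeneric_holds) P hα hv ha) fun hn P => ?_
  classical
  -- topological and measurable structures
  haveI : T2Space (GL (Fin n) (AdeleRing (𝓞 K) K)) := t2Space_gl n K
  haveI : LocallyCompactSpace (GL (Fin n) (AdeleRing (𝓞 K) K)) :=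
    AdelicGroupData.locallyCompactSpace_generalLinearGroup_adeleRing K (Fin n)
  haveI := secondCountableTopology_generalLinearGroup_adeleRing K (Fin n)
  haveI : T2Space (AdeleRing (𝓞 K) K) := t2Space_adeleRing K
  letI : MeasurableSpace (AdeleRing (𝓞 K) K) := borel _
  haveI : BorelSpace (AdeleRing (𝓞 K) K) := ⟨rfl⟩
  haveI := borelSpace_ideleGroup K
  haveI := locallyCompactSpace_ideleGroup K
  haveI := secondCountableTopology_ideleGroup K
  haveI := secondCountableTopology_adeleRing K
  haveI := locallyCompactSpace_adeleRing' K
  haveI : CompactSpace ↥(maximalCompactAdelic n K) :=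
    isCompact_iff_compactSpace.1 (isCompact_maximalCompactAdelic n K)
  haveI : LocallyCompactSpace ↥(adelicUnipotent n K) := (isClosed_adelicUnipotent n K).locallyCompactSpace
  haveI : SecondCountableTopology (AdelicGroupData.gl n K).Adelic :=
    secondCountableTopology_generalLinearGroup_adeleRing K (Fin n)
  haveI : SecondCountableTopology ↥(maximalCompactAdelic n K) := TopologicalSpace.Subtype.secondCountableTopology _
  -- Haar measures
  obtain ⟨νI, hνI⟩ := exists_isHaarMeasure_ideleGroup K
  haveI hνIR : νI.IsMulRightInvariant := by
    haveI := isInvInvariant_of_isHaarMeasure_ideleGroup (K := K) νI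
    infer_instance
  set μ : Measure (Fin n → AdeleRing (𝓞 K) K) := Measure.addHaar with hμ
  set νA : Measure (Fin n → ideleGroup K) := Measure.haar with hνA
  set νK : Measure ↥(maximalCompactAdelic n K) := Measure.haar with hνK
  set ν₀ : Measure ↥(adelicUnipotent n K) := Measure.haar with hν₀
  haveI hν₀R : ν₀.IsMulRightInvariant := isMulRightInvariant_of_isHaarMeasure_adelicUnipotent ν₀
  -- (1) a Satake family, the ramification of `ψ`, and the thin datum of the hypothesis
  obtain ⟨S₁, β₀, -, hβ₀⟩ := exists_isSatakeFamilyOf_holds (n := n) (K := K) (μ := μ') P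
  obtain ⟨Sψ, hSψ⟩ := exists_finset_adicComponent_adeleAddChar_unramified (K := K)
  obtain ⟨T, hT₀T, m, 𝔫₀, h𝔫₀, h𝔫₀T, f, η, hη, hηK, hW1, hfirst⟩ := hfin P (S₁ ∪ Sψ)
  have hηc : Continuous η := hη.continuous
  have hηs : HasCompactSupport η := hη.hasCompactSupport
  -- (2) the Whittaker coefficient
  have hψ : IsGlobalAddChar K (adeleAddChar K) := isGlobalAddChar_adeleAddChar (K := K)
  have h𝓕 : IsFundamentalDomain ↥(rationalUnipotent n K) (unipotentTateDomain n K) ν₀ :=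
    isFundamentalDomain_unipotentTateDomain ν₀
  have h𝓕c : IsCompact (closure (unipotentTateDomain n K)) := isCompact_closure_unipotentTateDomain
  have h𝓕m : MeasurableSet (unipotentTateDomain n K) := measurableSet_unipotentTateDomain
  set φ : GL (Fin n) (AdeleRing (𝓞 K) K) → ℂ :=
    invQuot (AdelicGroupData.gl n K) (smoothedForm η ((f : P.1.toSubmodule) : (AdelicGroupData.gl n K).L2 μ'))
    with hφ
  have hφc : Continuous φ := continuous_invQuot_smoothedForm hηc hηs _
  set W : GL (Fin n) (AdeleRing (𝓞 K) K) → ℂ :=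
    whittakerCoeff ν₀ (unipotentTateDomain n K) (adeleAddChar K) φ with hW
  have hWc : Continuous W := continuous_whittakerCoeff h𝓕m h𝓕c hψ.continuous hφc
  -- the base torus point `(1, 1)`
  have ha₀W : W (torusPoint n K ((1 : Fin n → ideleGroup K), (1 : ↥(maximalCompactAdelic n K)))) ≠ 0 := by
    have h1 : torusPoint n K ((1 : Fin n → ideleGroup K), (1 : ↥(maximalCompactAdelic n K))) = 1 := by
      rw [torusPoint, map_one, one_mul]
      rfl
    rw [h1]
    exact hW1 ν₀ inferInstance
  -- the non-vanishing of `S_η f` from that of its Whittaker coefficient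
  have hne : smoothedForm η ((f : P.1.toSubmodule) : (AdelicGroupData.gl n K).L2 μ') ≠ 0 := by
    intro h0
    apply hW1 ν₀ inferInstance
    have hφ0 : φ = 0 := by
      funext g
      rw [hφ, invQuot_apply, h0]
      rfl
    change whittakerCoeff ν₀ (unipotentTateDomain n K) (adeleAddChar K) φ 1 = 0
    rw [hφ0]
    exact whittakerCoeff_zero ν₀ _ _ 1
  -- (3) the exceptional finite set `S' = T`
  set S' : Set (HeightOneSpectrum (𝓞 K)) := ↑T with hS'
  have hS'fin : S'.Finite := T.finite_toSet
  have hS₁S' : (↑S₁ : Set (HeightOneSpectrum (𝓞 K))) ⊆ S' := by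
    intro v hv
    exact hT₀T (Finset.mem_union_left _ hv)
  have hgood : ∀ v ∉ S', ¬ v.asIdeal ∣ 𝔫₀ ∧ v ∉ Sψ := by
    intro v hv
    exact ⟨fun h => hv (h𝔫₀T v h), fun h => hv (hT₀T (Finset.mem_union_right _ h))⟩
  have hGood : ∀ v ∉ S', ¬ v.asIdeal ∣ 𝔫₀ ∧
      (∀ c ∈ 𝒪[v.adicCompletion K], (adeleAddChar K).adicComponent v c = 1) ∧
      ∀ ϖ : v.adicCompletion K, Valued.v ϖ = WithZero.exp (-1 : ℤ) →
        ∃ c ∈ 𝒪[v.adicCompletion K], (adeleAddChar K).adicComponent v (ϖ⁻¹ * c) ≠ 1 := by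
    intro v hv
    obtain ⟨h1, h2⟩ := hgood v hv
    exact ⟨h1, (hSψ v h2).1, (hSψ v h2).2⟩
  have ha₀unit : (1 : Fin n → ideleGroup K) ∈ unitBox {v : HeightOneSpectrum (𝓞 K) | v ∉ S'} := by
    intro v _ i
    rw [Pi.one_apply]
    exact (congrArg Valued.v (show (((1 : ideleGroup K) : AdeleRing (𝓞 K) K).2 v) = 1 from rfl)).trans
      (map_one _)
  -- enumerations of the Satake parameters off `S'`
  have hβ₀' : IsSatakeFamilyOf P S' β₀ := hβ₀.mono hS₁S'
  have hex : ∀ v : HeightOneSpectrum (𝓞 K), ∃ x : Fin n → ℂ,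
      v ∉ S' → (Finset.univ : Finset (Fin n)).val.map x = β₀ v := by
    intro v
    by_cases hv : v ∉ S'
    · obtain ⟨x, hx⟩ := exists_univ_val_map_eq (hβ₀'.card_eq hv)
      exact ⟨x, fun _ => hx⟩
    · exact ⟨fun _ => 0, fun h => absurd h hv⟩
  choose x hx using hex
  -- (4) the Gaussian thin test function
  set Φ : (Fin n → AdeleRing (𝓞 K) K) → ℝ := thinTestFun n K (gaussArchTestFun n K) T m with hΦ
  have hΦS : (fun y => (Φ y : ℂ)) ∈ piSchwartzBruhat K (Fin n) := thinTestFun_gauss_mem_piSchwartzBruhat n K T m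
  have hΦ0 : ∀ y, 0 ≤ Φ y := thinTestFun_gauss_nonneg n K T m
  have hΦc : Continuous Φ := continuous_thinTestFun_of_continuous (continuous_gaussArchTestFun n K) T m
  have hΦm : Measurable fun g : GL (Fin n) (AdeleRing (𝓞 K) K) => Φ (lastRow n K g) :=
    (hΦc.comp continuous_lastRow).measurable
  -- positivity of `Φ` at the base point: `e_n · 1 = e_n` lies in the thin box
  have hΦbase : 0 < Φ (lastRow n K (torusPoint n K ((1 : Fin n → ideleGroup K),
      (1 : ↥(maximalCompactAdelic n K))))) := by
    have h1 : torusPoint n K ((1 : Fin n → ideleGroup K), (1 : ↥(maximalCompactAdelic n K))) = 1 := by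
      rw [torusPoint, map_one, one_mul]
      rfl
    rw [h1]
    refine thinTestFun_gauss_pos_of_mem n K ?_
    have : (fun i => (lastRow n K (1 : GL (Fin n) (AdeleRing (𝓞 K) K)) i).2) = fun i : Fin n =>
        ((if (i : ℕ) + 1 = n then 1 else 0 : FiniteAdeleRing (𝓞 K) K)) := by
      funext i
      rw [lastRow, Units.val_one, Matrix.vecMul_one, lastBasisVec]
      split_ifs <;> rfl
    rw [this]
    exact lastBasisVec_mem_thinFiniteBox n K T m
  -- (5) the residue: `(s - 1) I(s) → r ≠ 0`
  obtain ⟨-, r, -, hr, hI⟩ := P.exists_residue_datum hn νI μ hΦS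
    (integral_ofReal_thinTestFun_gauss_ne_zero n K T m μ) hη f hne
  -- (6) the unfolding identity on the strip
  obtain ⟨C, hC, hunf⟩ :=
    exists_rankinSelbergIntegral_eq_mul_rankinSelbergTorusIntegralC (n := n) (K := K) hn μ' νI νA νK ν₀
  -- (7) the Euler factorisation on `Re s > 1`
  have hEuler : ∀ s : ℂ, 1 < s.re →
      rankinSelbergTorusIntegralC n K νA νK W Φ s =
        partialPairL S' β₀ (conjFamily β₀) s *
          ∫ p in unitBox {v | v ∉ S'} ×ˢ Set.univ, torusIntegrandC n K W Φ s p ∂(νA.prod νK) := by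
    intro s hs
    have hfin' : rankinSelbergTorusIntegral n K νA νK W Φ s.re ≠ ⊤ :=
      rankinSelbergTorusIntegral_whittakerCoeff_ne_top_of_mem_piSchwartzBruhat hn νA νK ν₀ P f hη hΦS hΦ0 hΦm hs
    have hpos := setLIntegral_torusIntegrand_unitBox_ne_zero_of_continuous hWc hΦc ha₀W hΦbase ha₀unit
      s.re νA νK
    exact rankinSelbergTorusIntegralC_whittakerCoeff_thin_eq_partialPairL_mul hn P hβ₀ h𝔫₀ hηc hηs hηK f h𝓕
      h𝓕m h𝓕c hψ m hS₁S' subset_rfl hGood (fun v hv => hx v hv) (fun z => (gaussArchTestFun_pos n K z).le)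
      hΦm νA νK hs hfin' hpos
  -- (8) the `S'`-part as a moment `∫ G w^s dm` over the restricted measure
  set X := (Fin n → ideleGroup K) × ↥(maximalCompactAdelic n K)
  set mm : Measure X := (νA.prod νK).restrict (unitBox {v | v ∉ S'} ×ˢ Set.univ) with hmm
  set G : X → ℝ := fun p =>
    ‖W (torusPoint n K p)‖ ^ 2 * Φ (lastRow n K (torusPoint n K p)) * torusWeight n K 0 p.1 with hG
  set w : X → ℝ := fun p => ∏ i : Fin n, ((IdeleClassGroup.ideleNorm K (p.1 i) : ℝ≥0) : ℝ) with hw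
  have hpt : Measurable (torusPoint n K) := continuous_torusPoint.measurable
  have hGm : Measurable G :=
    (((hWc.measurable.comp hpt).norm.pow_const 2).mul (hΦm.comp hpt)).mul
      ((continuous_torusWeight 0).measurable.comp measurable_fst)
  have hwm : Measurable w := by
    refine Finset.measurable_prod _ fun i _ => ?_
    exact measurable_coe_nnreal_real.comp
      ((continuous_ideleNorm_holds K).measurable.comp ((measurable_pi_apply i).comp measurable_fst))
  have hG0 : ∀ p, 0 ≤ G p := fun p =>
    mul_nonneg (mul_nonneg (sq_nonneg _) (hΦ0 _)) (torusWeight_nonneg 0 p.1)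
  have hw0 : ∀ p, 0 < w p := fun p => prod_ideleNorm_pos p.1
  have hmom : ∀ σ : ℝ, ∫⁻ p, ENNReal.ofReal (G p * w p ^ σ) ∂mm =
      ∫⁻ p in unitBox {v | v ∉ S'} ×ˢ Set.univ, torusIntegrand n K W Φ σ p ∂(νA.prod νK) := by
    intro σ
    refine lintegral_congr fun p => ?_
    rw [torusIntegrand_eq_ofReal_mul_rpow]
  have hintegrable : ∀ σ : ℝ,
      ∫⁻ p in unitBox {v | v ∉ S'} ×ˢ Set.univ, torusIntegrand n K W Φ σ p ∂(νA.prod νK) ≠ ⊤ →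
        Integrable (fun p => G p * w p ^ σ) mm := by
    intro σ hσ
    refine ⟨(hGm.mul (hwm.pow_const σ)).aestronglyMeasurable, ?_⟩
    rw [hasFiniteIntegral_iff_ofReal (Eventually.of_forall fun p =>
      mul_nonneg (hG0 p) (Real.rpow_nonneg (hw0 p).le σ)), hmom σ]
    exact lt_top_iff_ne_top.2 hσ
  have h1 : Integrable (fun p => G p * w p) mm := by
    have h := hintegrable 1 (hfirst νA inferInstance νK inferInstance ν₀ inferInstance)
    refine h.congr (Eventually.of_forall fun p => ?_)
    simp only [Real.rpow_one]
  have h2 : Integrable (fun p => G p * w p ^ (2 : ℝ)) mm := by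
    refine hintegrable 2 (ne_top_of_le_ne_top ?_ (setLIntegral_le_lintegral _ _))
    have h := rankinSelbergTorusIntegral_whittakerCoeff_ne_top_of_mem_piSchwartzBruhat hn νA νK ν₀ P f hη hΦS
      hΦ0 hΦm (σ := 2) (by norm_num)
    exact h
  -- the identity `I(s) = C · (∫ G w^s dm) · L^{S'}(s)` on the strip
  have hstrip : ∀ᶠ s in 𝓝[{s : ℂ | 1 < s.re}] 1, 1 < s.re ∧ s.re < 2 := by
    have h2' : ∀ᶠ s in 𝓝 (1 : ℂ), s.re < 2 :=
      (Complex.continuous_re.tendsto (1 : ℂ)).eventually (eventually_lt_nhds (by norm_num))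
    exact eventually_mem_nhdsWithin.and (eventually_nhdsWithin_of_eventually_nhds h2')
  have hid : ∀ᶠ s in 𝓝[{s : ℂ | 1 < s.re}] 1,
      rankinSelbergIntegral μ' νI (fun y => (Φ y : ℂ)) s
          (star (smoothedForm η ((f : P.1.toSubmodule) : (AdelicGroupData.gl n K).L2 μ')))
          (smoothedForm η ((f : P.1.toSubmodule) : (AdelicGroupData.gl n K).L2 μ')) =
        (C : ℂ) * (∫ p, (G p : ℂ) * (w p : ℂ) ^ s ∂mm) * partialPairL S' β₀ (conjFamily β₀) s := by
    filter_upwards [hstrip] with s hs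
    have hset : (∫ p in unitBox {v | v ∉ S'} ×ˢ Set.univ, torusIntegrandC n K W Φ s p ∂(νA.prod νK)) =
        ∫ p, (G p : ℂ) * (w p : ℂ) ^ s ∂mm := by
      rw [hmm]
      exact integral_congr_ae (Eventually.of_forall fun p => torusIntegrandC_eq_ofReal_mul_cpow s p)
    rw [hunf P f hη hΦS hΦ0 hΦm hs.1 hs.2, hEuler s hs.1, hset]
    ring
  -- (9) the moment lemma
  refine ⟨S', β₀, hS'fin, hβ₀', ?_⟩
  exact exists_ne_zero_tendsto_sub_one_mul_of_integral_mul_cpow hr (Complex.ofReal_ne_zero.2 hC.ne') hI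
    hGm hwm hG0 hw0 h1 h2 hid

end FirstMoment

end Literature.NumberTheory.Automorphic
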